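import Literature.NumberTheory.LFunctions.LandauOscillation

/-!
# The `D = 0` rung of `PolyaLandau` (route `ScrewPolyaSigns`, crux item stmt-RiemannHypothesis-24181)

BC5 witness for the crux `PolyaLandau` (quantitative Pólya–Landau): the case `D = 0` — a measurable
`g` with a *bounded number* of sign changes on `(1, ∞)` whose Mellin transform continues
holomorphically to `{Re s > σ₁} ∪ W₀`, `W₀ ⊇ (a, σ₁ + 1]` convex open, is absolutely
Mellin-integrable at every `σ > a`. A bounded number of sign changes makes `g` eventually of one
sign, and the tree's Landau lemma `Landau.integrableOn_of_differentiableOn_union_convex` (applied to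
`g` or to `-g`) does the rest. This is exactly the registered stub `stub_rung_D0` of the birth
skeleton of `PolyaLandau`; it is ζ-free. Nothing here bears on the truth of RH.
-/

open Set MeasureTheory Filter Literature.NumberTheory.LFunctions

namespace Summit.RiemannHypothesis.RiemannHypothesis.Theorems.PolyaLandauRung

/-- A chain-length bound with `D = 0` (at most `B` strict sign alternations of `g` on every `(1, X]`)
forces `g` to be of one sign beyond some point. [folklore] -/
theorem eventually_one_sign_of_chainBound {g : ℝ → ℝ} {B : ℝ}
    (hchain : ∀ X : ℝ, 1 ≤ X → ∀ (n : ℕ) (x : Fin (n + 1) → ℝ), StrictMono x →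
      (∀ i, x i ∈ Set.Ioc 1 X) → (∀ i : Fin n, g (x i.castSucc) * g (x i.succ) < 0) →
      (n : ℝ) ≤ 0 * Real.log X + B) :
    ∃ X₁ : ℝ, 1 ≤ X₁ ∧ ((∀ x, X₁ < x → 0 ≤ g x) ∨ (∀ x, X₁ < x → g x ≤ 0)) := by
  by_cases h0 : ∀ x : ℝ, 1 < x → g x = 0
  · exact ⟨1, le_rfl, Or.inl fun x hx ↦ (h0 x hx).symm.le⟩
  push Not at h0
  obtain ⟨x₀, hx₀, hgx₀⟩ := h0
  -- admissible chains: strictly increasing points of `(1, ∞)`, strictly alternating signs,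
  -- last value non-zero; `S` = the set of their lengths
  set S : Set ℕ := {n | ∃ x : Fin (n + 1) → ℝ, StrictMono x ∧ (∀ i, 1 < x i) ∧
      (∀ i : Fin n, g (x i.castSucc) * g (x i.succ) < 0) ∧ g (x (Fin.last n)) ≠ 0} with hS
  have h0S : 0 ∈ S := ⟨fun _ ↦ x₀, fun i j h ↦ absurd h (by simp [Fin.eq_zero i, Fin.eq_zero j]),
    fun _ ↦ hx₀, fun i ↦ i.elim0, hgx₀⟩
  have hSne : S.Nonempty := ⟨0, h0S⟩
  have hSbdd : BddAbove S := by
    refine ⟨⌊B⌋₊, fun n hn ↦ ?_⟩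
    obtain ⟨x, hxm, hx1, hxalt, -⟩ := hn
    have hX : 1 ≤ x (Fin.last n) := (hx1 _).le
    have hle : (n : ℝ) ≤ 0 * Real.log (x (Fin.last n)) + B :=
      hchain _ hX n x hxm (fun i ↦ ⟨hx1 i, hxm.monotone (Fin.le_last i)⟩) hxalt
    rw [zero_mul, zero_add] at hle
    exact Nat.le_floor hle
  set N := sSup S with hN
  have hNS : N ∈ S := Nat.sSup_mem hSne hSbdd
  obtain ⟨x, hxm, hx1, hxalt, hlast⟩ := hNS
  refine ⟨x (Fin.last N), (hx1 _).le, ?_⟩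
  -- no later point may alternate with the last one, else the chain extends
  have key : ∀ y : ℝ, x (Fin.last N) < y → 0 ≤ g (x (Fin.last N)) * g y := by
    intro y hy
    by_contra hneg
    push Not at hneg
    have hgy : g y ≠ 0 := fun h ↦ by simp [h] at hneg
    have hmem : N + 1 ∈ S := by
      refine ⟨Fin.snoc x y, ?_, ?_, ?_, ?_⟩
      · rw [Fin.strictMono_iff_lt_succ]
        intro i
        rcases Fin.eq_castSucc_or_eq_last i with ⟨j, rfl⟩ | rfl
        · rw [Fin.succ_castSucc, Fin.snoc_castSucc, Fin.snoc_castSucc]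
          exact hxm (Fin.castSucc_lt_succ (i := j))
        · rw [Fin.succ_last, Fin.snoc_last, Fin.snoc_castSucc]
          exact hy
      · intro i
        rcases Fin.eq_castSucc_or_eq_last i with ⟨j, rfl⟩ | rfl
        · rw [Fin.snoc_castSucc]; exact hx1 j
        · rw [Fin.snoc_last]; exact (hx1 _).trans hy
      · intro i
        rcases Fin.eq_castSucc_or_eq_last i with ⟨j, rfl⟩ | rfl
        · rw [Fin.succ_castSucc, Fin.snoc_castSucc, Fin.snoc_castSucc]
          exact hxalt j
        · rw [Fin.succ_last, Fin.snoc_last, Fin.snoc_castSucc]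
          exact hneg
      · simpa [Fin.snoc_last] using hgy
    have : N + 1 ≤ N := le_csSup hSbdd hmem
    omega
  rcases lt_or_gt_of_ne hlast with hlt | hgt
  · exact Or.inr fun y hy ↦ nonpos_of_mul_nonneg_right (by simpa [mul_comm] using key y hy) hlt
  · exact Or.inl fun y hy ↦ nonneg_of_mul_nonneg_right (key y hy) hgt

/-- `mellinIoi` is odd in `g`. [folklore] -/
theorem mellinIoi_neg (g : ℝ → ℝ) (s : ℂ) :
    Landau.mellinIoi (fun x ↦ -g x) s = -Landau.mellinIoi g s := by
  simp [Landau.mellinIoi, neg_mul, integral_neg]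

/-- **The `D = 0` rung of `PolyaLandau`** (= the registered stub `stub_rung_D0` of its birth
skeleton): Pólya–Landau for a bounded number of sign changes is Landau's lemma applied to `g` or
`-g` beyond the last sign change. [cite: MontgomeryVaughan2007, §15.1 Lemma 15.1] -/
theorem stub_rung_D0 (g : ℝ → ℝ) (σ₁ a B : ℝ) (hg : Measurable g)
    (hint : IntegrableOn (fun x : ℝ ↦ g x * x ^ (-(σ₁ + 1))) (Ioi 1))
    (hchain : ∀ X : ℝ, 1 ≤ X → ∀ (n : ℕ) (x : Fin (n + 1) → ℝ), StrictMono x →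
      (∀ i, x i ∈ Set.Ioc 1 X) → (∀ i : Fin n, g (x i.castSucc) * g (x i.succ) < 0) →
      (n : ℝ) ≤ 0 * Real.log X + B)
    (ha : a < σ₁) (W₀ : Set ℂ) (hW₀o : IsOpen W₀) (hW₀c : Convex ℝ W₀)
    (hW₀r : {s : ℂ | a < s.re ∧ s.re ≤ σ₁ + 1 ∧ |s.im| ≤ Real.pi * 0} ⊆ W₀)
    (Φ : ℂ → ℂ) (hΦ : DifferentiableOn ℂ Φ ({s : ℂ | σ₁ < s.re} ∪ W₀))
    (hagree : EqOn Φ (Landau.mellinIoi g) {s : ℂ | σ₁ < s.re}) (σ : ℝ) (hσ : a < σ) :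
    IntegrableOn (fun x : ℝ ↦ g x * x ^ (-(σ + 1))) (Ioi 1) := by
  have hW₀r' : ∀ σ' : ℝ, a < σ' → σ' ≤ σ₁ + 1 → (σ' : ℂ) ∈ W₀ :=
    fun σ' h1 h2 ↦ hW₀r ⟨by simpa using h1, by simpa using h2, by simp⟩
  obtain ⟨X₁, hX₁, hpos | hnonpos⟩ := eventually_one_sign_of_chainBound hchain
  · exact Landau.integrableOn_of_differentiableOn_union_convex hg hint hX₁ hpos ha hW₀o hW₀c
      hW₀r' hΦ hagree hσ
  · -- apply Landau's lemma to `-g`, whose transform is `-Φ`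
    have hg' : Measurable (fun x ↦ -g x) := hg.neg
    have hint' : IntegrableOn (fun x : ℝ ↦ (-g x) * x ^ (-(σ₁ + 1))) (Ioi 1) := by
      simpa [neg_mul] using hint.neg
    have hpos' : ∀ x, X₁ < x → 0 ≤ -g x := fun x hx ↦ neg_nonneg.2 (hnonpos x hx)
    have hΦ' : DifferentiableOn ℂ (fun s ↦ -Φ s) ({s : ℂ | σ₁ < s.re} ∪ W₀) := hΦ.neg
    have hagree' : EqOn (fun s ↦ -Φ s) (Landau.mellinIoi fun x ↦ -g x) {s : ℂ | σ₁ < s.re} := by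
      intro s hs
      simp only [mellinIoi_neg, hagree hs]
    have h := Landau.integrableOn_of_differentiableOn_union_convex hg' hint' hX₁ hpos' ha hW₀o
      hW₀c hW₀r' hΦ' hagree' hσ
    simpa [neg_mul] using h.neg

end Summit.RiemannHypothesis.RiemannHypothesis.Theorems.PolyaLandauRung
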